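import Literature.MathematicalPhysics.QuantumFieldTheory.Balaban1983to89.Beta.DecimatedMomentSummable

/-!
# `BalabanUV.Beta.FP.ConvolutionAbsMoment` — road «FP» (binder row D1), row **RHOA-7** companion: THE ONE-SIDED LATTICE CONVOLUTION PRESERVES THE
# LETTER `AbsMoment₂` (absolutely summable second moment), WITH THE DISPLAYED CONSTANT `2·(Σ'(1+|u|₁²)|G u|)·(Σ'(1+|x|₁²)|g x|)`
# ([folklore] unconditional sums on `ℤ^d × ℤ^d`; abstract kernels; NO road object)

HONEST DEPENDENCY (page 1, mandatory): continuum YM on T⁴ ⇐ BetaPertH ∧ nine spine estimates (0/9 proved); BetaPertH ⇐ (D1) ∧ (D4) ∧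
CAP+tail; G-an2-4 gates asym, D1 and NE2/3/4.  HONEST FRAMING (cell contract, verbatim): «discharging `BetaPertH` makes Bałaban's UV
stability UNCONDITIONAL — a real constructive-QFT result; it is NOT the continuum limit and NOT the Clay problem.»  THIS MODULE is elementary
[folklore] analysis of unconditional sums (Mathlib `Summable.mul_of_nonneg`, `Summable.prod`, `Summable.tsum_prod`, `Summable.tsum_mul_tsum`,
`norm_tsum_le_tsum_norm`) over b12's letter `DecimatedMomentSummable.AbsMoment₂` and `B12Sec2to5.l1`; it asserts nothing about Bałaban's objects,
cites nothing, mints no `Prop` fact, has no `def`, 0 sorry.  NOT `Mix_n = O(1)`, NOT `hbook`, NOT D1, NOT BetaPertH, NOT continuum, NOT Clay.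

ABSOLUTE RULE (cell charter, verbatim): «No internally-minted statement may enter as a cited fact. Every hypothesis is either kernel-proved in
this package or a verbatim quotation of a PUBLISHED theorem with page reference. The manuscript(s) under audit are NOT citable for their own
disputed steps — they are the thing under adjudication; programme-internal (2001/route/tribunal) claims are never citable.»

WHY (owner memo `RHOA-DESIGN.md` v1.1 §5 row RHOA-7 «… a kernel `k = Δ^c ∘ (bounded, n-uniformly summable)` … finite, n-uniform given RHOA-6-type
letters; displayed constant»; orientation only).  The sister module `FP/MultiplierVertexMoment` computes the second moment of the loop kernel
`y ↦ Σ'_x G (y − x)·g x` (one external leg = a coarse e.o.m. kernel `G`).  For that kernel to be fed to any FURTHER bookkeeping of the road (a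
transport `Wᵀ·k·W`, `secondMoment_add`, a second convolution) it must itself carry the class letter `AbsMoment₂`; this file proves that the class
is closed under convolution, with an explicit constant, so «n-uniform given the letters» propagates: if the two letters are n-uniform, so is the
letter of the loop kernel.

CONTENT.  `one_add_l1_add_sq_le` (`1 + |u+x|₁² ≤ 2(1+|u|₁²)(1+|x|₁²)`, over b12's `DecimatedMomentLimit.l1_add_le`), `summable_norm_conv_fibre` (every
fibre `x ↦ G(y−x)·g x` is absolutely summable), **`tsum_absMoment₂_conv_le`** (`Σ'_y (1+|y|₁²)·|Σ'_x G(y−x)·g x| ≤ 2·A_G·A_g` together with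
`AbsMoment₂` of the convolution — change of variables `(u, x) ↦ (u + x, x)` on `ℤ^d × ℤ^d` against the product majorant), **`absMoment₂_conv`**,
`absMoment₂_conv_kernel` (`B12Beta.Kernel d`-valued inner kernel).
Provenance: cross-cell idle-seat kernel duty NE7b → β∕D1, unit `b2b-balaban-t4-ne7b-formalise-leaf-10` gen 24 (prover-…-leaf-10-g24-0), 2026-08-21;
journal INTENT ∕ CLAIM «RHOA-7» l.24534; «not in print; our bookkeeping»; no existing file touched.
-/

noncomputable section

namespace Summit.QuantumFields.BalabanUV.Beta.FP.ConvolutionAbsMoment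

open Finset Filter Topology
open scoped BigOperators
open Literature.MathematicalPhysics.QuantumFieldTheory.Balaban1983to89
open Literature.MathematicalPhysics.QuantumFieldTheory.Balaban1983to89.Beta
open DecimatedMomentLimit (l1_add_le)
open DecimatedMomentSummable (AbsMoment₂)
open B12Sec2to5 (l1 l1_nonneg)

variable {d : ℕ}

/-! ## The convolution preserves `AbsMoment₂` -/

/-- [folklore] `1 + |u + x|₁² ≤ 2·(1 + |u|₁²)·(1 + |x|₁²)`. -/
theorem one_add_l1_add_sq_le (u x : Fin d → ℤ) :
    1 + l1 (u + x) ^ 2 ≤ 2 * ((1 + l1 u ^ 2) * (1 + l1 x ^ 2)) := by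
  have h := l1_add_le u x
  have hu := l1_nonneg u
  have hx := l1_nonneg x
  have hux := l1_nonneg (u + x)
  have h2 : l1 (u + x) ^ 2 ≤ (l1 u + l1 x) ^ 2 := pow_le_pow_left₀ hux h 2
  nlinarith [sq_nonneg (l1 u - l1 x), mul_nonneg hu hx, sq_nonneg (l1 u * l1 x), h2]

/-- [folklore] **THE LATTICE CONVOLUTION PRESERVES `AbsMoment₂`, WITH THE DISPLAYED CONSTANT**:
`Σ'_y (1 + |y|₁²)·|Σ'_x G(y−x)·g x| ≤ 2·(Σ'_u (1+|u|₁²)|G u|)·(Σ'_x (1+|x|₁²)|g x|)`; in particular the loop kernel of §3 is again a kernel of the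
class and can be fed to any further bookkeeping (`secondMoment_add`, transport, a second convolution).  Change of variables `(u, x) ↦ (u + x, x)` on
`ℤ^d × ℤ^d`, `Summable.mul_of_nonneg`, `Summable.prod`, `Summable.tsum_prod`, `Summable.tsum_mul_tsum`. -/
theorem tsum_absMoment₂_conv_le (G g : (Fin d → ℤ) → ℝ) (hG : AbsMoment₂ G) (hg : AbsMoment₂ g) :
    AbsMoment₂ (fun y => ∑' x, G (y - x) * g x)
      ∧ ∑' y, (1 + l1 y ^ 2) * |∑' x, G (y - x) * g x|
          ≤ 2 * ((∑' u, (1 + l1 u ^ 2) * |G u|) * (∑' x, (1 + l1 x ^ 2) * |g x|)) := by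
  -- the product majorant in the coordinates `(u, x)`, `u = y − x`
  have hnnG : ∀ u : Fin d → ℤ, 0 ≤ (1 + l1 u ^ 2) * |G u| := fun u => mul_nonneg (by positivity) (abs_nonneg _)
  have hnng : ∀ x : Fin d → ℤ, 0 ≤ (1 + l1 x ^ 2) * |g x| := fun x => mul_nonneg (by positivity) (abs_nonneg _)
  have hprod : Summable (fun p : (Fin d → ℤ) × (Fin d → ℤ) => ((1 + l1 p.1 ^ 2) * |G p.1|) * ((1 + l1 p.2 ^ 2) * |g p.2|)) :=
    hG.mul_of_nonneg hg hnnG hnng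
  set F : (Fin d → ℤ) × (Fin d → ℤ) → ℝ :=
    fun p => 2 * (((1 + l1 p.1 ^ 2) * |G p.1|) * ((1 + l1 p.2 ^ 2) * |g p.2|)) with hF
  have hFs : Summable F := hprod.mul_left 2
  -- the weighted absolute integrand in the coordinates `(y, x)`
  set H : (Fin d → ℤ) × (Fin d → ℤ) → ℝ := fun p => (1 + l1 p.1 ^ 2) * |G (p.1 - p.2) * g p.2| with hH
  have hHn : ∀ p, 0 ≤ H p := fun p => mul_nonneg (by positivity) (abs_nonneg _)
  let e : (Fin d → ℤ) × (Fin d → ℤ) ≃ (Fin d → ℤ) × (Fin d → ℤ) :=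
    { toFun := fun p => (p.1 + p.2, p.2)
      invFun := fun p => (p.1 - p.2, p.2)
      left_inv := fun p => by simp
      right_inv := fun p => by simp }
  have hHe : ∀ p, H (e p) ≤ F p := fun p => by
    obtain ⟨u, x⟩ := p
    show (1 + l1 (u + x) ^ 2) * |G (u + x - x) * g x| ≤ 2 * (((1 + l1 u ^ 2) * |G u|) * ((1 + l1 x ^ 2) * |g x|))
    rw [add_sub_cancel_right, abs_mul]
    have h1 := one_add_l1_add_sq_le u x
    have h0 : 0 ≤ |G u| * |g x| := by positivity
    calc (1 + l1 (u + x) ^ 2) * (|G u| * |g x|) ≤ 2 * ((1 + l1 u ^ 2) * (1 + l1 x ^ 2)) * (|G u| * |g x|) :=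
          mul_le_mul_of_nonneg_right h1 h0
      _ = 2 * (((1 + l1 u ^ 2) * |G u|) * ((1 + l1 x ^ 2) * |g x|)) := by ring
  have hHes : Summable (fun p => H (e p)) := Summable.of_nonneg_of_le (fun p => hHn _) hHe hFs
  have hHs : Summable H := (Equiv.summable_iff e).mp hHes
  -- fibres: for each `y`, `x ↦ G (y − x)·g x` is absolutely summable
  have hfibn : ∀ y, Summable (fun x => ‖G (y - x) * g x‖) := fun y => by
    have h1 : Summable (fun x => H (y, x)) := hHs.prod_factor y
    have hpos : (0 : ℝ) < 1 + l1 y ^ 2 := by positivity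
    refine (h1.mul_left (1 + l1 y ^ 2)⁻¹).congr (fun x => ?_)
    show (1 + l1 y ^ 2)⁻¹ * ((1 + l1 y ^ 2) * |G (y - x) * g x|) = ‖G (y - x) * g x‖
    rw [← mul_assoc, inv_mul_cancel₀ hpos.ne', one_mul, Real.norm_eq_abs]
  -- the row bound `(1 + |y|₁²)·|Σ'_x …| ≤ Σ'_x H (y, x)`
  have hrow : ∀ y, (1 + l1 y ^ 2) * |∑' x, G (y - x) * g x| ≤ ∑' x, H (y, x) := fun y => by
    have h1 : |∑' x, G (y - x) * g x| ≤ ∑' x, |G (y - x) * g x| := by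
      have := norm_tsum_le_tsum_norm (hfibn y)
      simpa only [Real.norm_eq_abs] using this
    calc (1 + l1 y ^ 2) * |∑' x, G (y - x) * g x| ≤ (1 + l1 y ^ 2) * ∑' x, |G (y - x) * g x| :=
          mul_le_mul_of_nonneg_left h1 (by positivity)
      _ = ∑' x, H (y, x) := by
          show (1 + l1 y ^ 2) * ∑' x, |G (y - x) * g x| = ∑' x, (1 + l1 y ^ 2) * |G (y - x) * g x|
          rw [tsum_mul_left]
  have hsum : Summable (fun y => ∑' x, H (y, x)) := hHs.prod
  have hA : AbsMoment₂ (fun y => ∑' x, G (y - x) * g x) :=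
    Summable.of_nonneg_of_le (fun y => mul_nonneg (by positivity) (abs_nonneg _)) hrow hsum
  refine ⟨hA, ?_⟩
  calc ∑' y, (1 + l1 y ^ 2) * |∑' x, G (y - x) * g x| ≤ ∑' y, ∑' x, H (y, x) := hA.tsum_le_tsum hrow hsum
    _ = ∑' p, H p := hHs.tsum_prod.symm
    _ = ∑' p, H (e p) := (Equiv.tsum_eq e H).symm
    _ ≤ ∑' p, F p := hHes.tsum_le_tsum hHe hFs
    _ = 2 * ((∑' u, (1 + l1 u ^ 2) * |G u|) * (∑' x, (1 + l1 x ^ 2) * |g x|)) := by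
        rw [hG.tsum_mul_tsum hg hprod]
        exact tsum_mul_left

/-- [folklore] **THE CLASS `AbsMoment₂` IS CLOSED UNDER CONVOLUTION.** -/
theorem absMoment₂_conv (G g : (Fin d → ℤ) → ℝ) (hG : AbsMoment₂ G) (hg : AbsMoment₂ g) :
    AbsMoment₂ (fun y => ∑' x, G (y - x) * g x) :=
  (tsum_absMoment₂_conv_le G g hG hg).1

/-- [folklore] Every fibre `x ↦ G (y − x)·g x` of the convolution of two `AbsMoment₂` kernels is absolutely summable (so the inner `tsum` is an
honest sum). -/
theorem summable_norm_conv_fibre (G g : (Fin d → ℤ) → ℝ) (hG : AbsMoment₂ G) (hg : AbsMoment₂ g) (y : Fin d → ℤ) :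
    Summable (fun x => ‖G (y - x) * g x‖) := by
  have hGb : ∀ s, |G s| ≤ ∑' t, (1 + l1 t ^ 2) * |G t| := fun s => by
    have h1 : |G s| ≤ (1 + l1 s ^ 2) * |G s| := by
      have := abs_nonneg (G s)
      nlinarith [sq_nonneg (l1 s)]
    exact h1.trans (hG.le_tsum s (fun t _ => mul_nonneg (by positivity) (abs_nonneg _)))
  have hga : Summable (fun x => |g x|) := (DecimatedMomentSummable.summable_of_absMoment₂ hg).abs
  refine Summable.of_nonneg_of_le (fun _ => norm_nonneg _) (fun x => ?_) (hga.mul_left (∑' t, (1 + l1 t ^ 2) * |G t|))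
  rw [Real.norm_eq_abs, abs_mul]
  exact mul_le_mul_of_nonneg_right (hGb _) (abs_nonneg _)

/-- [folklore] … so, with one e.o.m. leg, the loop kernel `k μ ν y := Σ'_x G (y − x)·g μ ν x` of `FP/MultiplierVertexMoment` §3 carries the class
letter again: both its second moment (there) and its absolute second moment (here) are bounded by displayed products of the two letters — the
shape of the `hD`∕`hT` slots of `FP/HorizontalTailAssemblyDefect.abs_secondMoment_sub_window_le_defect`. -/
theorem absMoment₂_conv_kernel (G : (Fin d → ℤ) → ℝ) (g : B12Beta.Kernel d) (μ ν : Fin d) (hG : AbsMoment₂ G)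
    (hg : AbsMoment₂ (g μ ν)) : AbsMoment₂ (fun y => ∑' x, G (y - x) * g μ ν x) :=
  absMoment₂_conv G (g μ ν) hG hg

end Summit.QuantumFields.BalabanUV.Beta.FP.ConvolutionAbsMoment

end
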